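/- Width seat `ym-line-sfw-p2-w5` (prover-ym-line-sfw-p2-w5-g19-0), free hands on planner ym-idea-2 g17's typed task T-U2.S
(`Cruxes/BoxWindowHighSU2213/TaskU2S.lean`, STUB-PLAN-U2 rev 2 §3) for LINE-20 «landau-rung3» stub U2 on ⟨stmt-QuantumFields-24336⟩. -/
import Summits.QuantumFields.YangMills.Theorems.AllWindowsColdBoxBoxHighLineUniformGaugeLinks

/-!
# T-U2.S («uniformised temporal gauge»), part 3b: `UniformGaugeBound` and `SharpStageI` PROVED

The sharp Stage I of LINE-20 U2 (planner ym-idea-2 g17, STUB-PLAN-U2 rev 2 §3.2–3.3): on `ColdWall H U ∧ SmallPlaquettes H s U` with `s·H² ≤ 1/16` the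
interior gauge transform `uniformGauge H U = spreadGauge · forestGauge` puts EVERY box link within quaternion distance `150·H·s` of `1`
(`ellq_uniform_link_le`), hence `uniformGaugeBound : UniformGaugeBound` (`C = 150`, `c = 1/16`) and, summing over `#boxEdges ≤ 4(2H+1)⁴ ≤ 324 H⁴` links,
`sharpStageI : SharpStageI` (`C = 7290000`, `c = 1/16`).  The forest links are read off the tree's abstract Poincaré ladder
(`WeakCouplingRates.ell_spatial`, `ell_spatial_bottom`, `ell_temporal_face`, `ell_le_uniform`) instantiated with the quaternion length `ellq` (part 1);
the column holonomies `h_y = forestFix H U ((0,y),e₀)` (the only `H²·s` links) are spread over their columns by `k_y^{2H−x₀}`, `k_y = kroot (2H) h_y`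
(`temporal_link_eq`: every temporal link of an interior column becomes `k_y`, `‖q(k_y) − 1‖ ≤ (π/2)·15H²s/(2H)`); spatial links between interior columns
move by `‖q(k_y^t) − q(k_{y'}^t)‖ ≤ t·18·‖q(h_y) − q(h_{y'})‖/(2H) ≤ 18·8Hs` (root Lipschitz, part 1; neighbouring column holonomies differ by `≤ 8Hs`
through the bottom plaquette, `norm_colHol_sub_le`), and next to a side face by `t·‖q(k_y) − 1‖ ≤ (π/2)·‖q(h_y) − 1‖ ≤ 2·(8H+1)s` (face columns are skin).

This module (3b): §5 the per-link bound `ellq_uniform_link_le` (temporal `≤ 15Hs`, spatial `≤ 150Hs`), §6 `uniformGaugeBound`, `sharpStageI`; the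
link identities and forest inputs are part 3a `…UniformGaugeLinks`.  Everything proved, Mathlib + tree only; no definition, no sorry; standard axioms.
HONEST LABEL: the typed task T-U2.S (a free-standing INPUT of the
bootstrap re-run for the OPEN stub U2 `stub_landauRepresentativeStrong : LandauRepresentativeBound`) of a critic-PASSed DRAFT-by-design line on the R2ξ″
RECORD-rung crux ⟨24336⟩; no stub is proved by name, no crux, rung or summit is proved; the Yang–Mills mass gap is NOT proved by this file.
-/

set_option autoImplicit false

noncomputable section

open scoped Real Quaternion
open Literature.MathematicalPhysics.QuantumFieldTheory hiding boxEdges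
open Literature.MathematicalPhysics.QuantumFieldTheory.LatticeMaxwell
open Literature.MathematicalPhysics.QuantumFieldTheory.AxialGauge
open Summit.QuantumFields.YangMills.Theorems.WeakCouplingRates
open Literature.Probability.LatticeModels (Site)
open Literature.MathematicalPhysics.QuantumLattice
open Literature.MathematicalPhysics.QuantumFieldTheory.Balaban1983to89.T4HaarSU2Translate (su2Quat_mul su2Quat_one)

namespace Summit.QuantumFields.YangMills.Theorems.AllWindowsColdBoxBoxHighLine.UniformGauge

variable {H : ℕ}

/-! ## §5 The per-link bound `ℓ ≤ 150·H·s` -/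

section Bound

variable {s : ℝ} {U : LGConfig 4 SU2}

/-- Column holonomies have `Re q ≥ 0` under `s·H² ≤ 1/16` (`ℓ(h_y) ≤ 15H²s ≤ 1`). -/
theorem re_colHol_nonneg (hH : 1 ≤ H) (hs : 0 ≤ s) (hc : s * (H : ℝ) ^ 2 ≤ 1 / 16) (hW : ColdWall H U)
    (hS : SmallPlaquettes H s U) (e : Literature.MathematicalPhysics.QuantumLattice.ZdEdge 4) :
    0 ≤ (su2Quat (forestFix H U e)).re := by
  refine re_su2Quat_nonneg_of_norm_sub_one_le ?_
  have h := ellq_forestFix_le hH hs hW hS e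
  rw [ellq] at h
  nlinarith

/-- **Temporal links of the uniformised configuration**: `ℓ ≤ 15·H·s` on the cold box. -/
theorem ellq_uniform_temporal_le (hH : 1 ≤ H) (hs : 0 ≤ s) (hW : ColdWall H U) (hS : SmallPlaquettes H s U)
    {x : Site 4} (hx : ((x, (0 : Fin 4)) : Literature.MathematicalPhysics.QuantumLattice.ZdEdge 4) ∈ boxEdges 4 (2 * H + 1)) :
    ellq (gaugeTransformZd (spreadGauge H U) (forestFix H U) (x, 0)) ≤ 15 * (H : ℝ) * s := by
  have hH' : (1 : ℝ) ≤ H := by exact_mod_cast hH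
  have hHpos : (0 : ℝ) < H := by linarith
  have hbox := mem_boxEdges_iff.1 hx
  have h0 : 0 ≤ x 0 := (hbox.1 0).1
  have h1 : x 0 + 1 ≤ 2 * (H : ℤ) := by have := hbox.2; push_cast at this; omega
  by_cases hsp : ∀ k : Fin 4, k ≠ 0 → 1 ≤ x k ∧ x k + 1 ≤ 2 * (H : ℤ)
  · -- interior column: the link is the root `k_y`
    rw [temporal_link_eq hH U hsp h0 h1]
    have hk := norm_kroot_sub_one_le (2 * H) (forestFix H U (col x, 0))
    have hh := ellq_forestFix_le hH hs hW hS (col x, 0)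
    rw [ellq] at hh ⊢
    have hπ := Real.pi_le_four
    calc ‖su2Quat (kroot (2 * H) (forestFix H U (col x, 0))) - 1‖
        ≤ π / 2 * ‖su2Quat (forestFix H U (col x, 0)) - 1‖ / ((2 * H : ℕ) : ℝ) := hk
      _ ≤ 2 * (15 * (H : ℝ) ^ 2 * s) / (2 * (H : ℝ)) := by
          push_cast
          gcongr
          linarith
      _ = 15 * (H : ℝ) * s := by field_simp
  · -- a face column: both gauge factors are `1`, the link is a skin link
    push Not at hsp
    obtain ⟨j, hj, hjx⟩ := hsp
    have hxj := hbox.1 j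
    have hface : x j = 0 ∨ x j = 2 * (H : ℤ) := by
      push_cast at hxj
      by_cases h1j : 1 ≤ x j
      · have := hjx h1j; omega
      · omega
    have hnx : ¬ ∀ k : Fin 4, 1 ≤ x k ∧ x k + 1 ≤ 2 * (H : ℤ) := fun h => by have := h j; omega
    have hnx' : ¬ ∀ k : Fin 4, 1 ≤ (x + Pi.single (0 : Fin 4) (1 : ℤ) : Site 4) k ∧ (x + Pi.single (0 : Fin 4) (1 : ℤ) : Site 4) k + 1 ≤ 2 * (H : ℤ) := by
      intro h
      have := h j
      simp only [Pi.add_apply, Pi.single_eq_of_ne hj, add_zero] at this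
      omega
    show ellq (spreadGauge H U x * forestFix H U (x, 0) * (spreadGauge H U (x + Pi.single 0 1))⁻¹) ≤ _
    rw [spreadGauge_of_not_interior U hnx, spreadGauge_of_not_interior U hnx', one_mul, inv_one, mul_one]
    have h := ellq_forestFix_temporal_face_le hs hW hS hj hface
    nlinarith

/-- **Spatial links of the uniformised configuration**: `ℓ ≤ 150·H·s` on the cold box (`s·H² ≤ 1/16`). -/
theorem ellq_uniform_spatial_le (hH : 1 ≤ H) (hs : 0 ≤ s) (hc : s * (H : ℝ) ^ 2 ≤ 1 / 16) (hW : ColdWall H U)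
    (hS : SmallPlaquettes H s U) {x : Site 4} {i : Fin 4} (hi : i ≠ 0)
    (hx : ((x, i) : Literature.MathematicalPhysics.QuantumLattice.ZdEdge 4) ∈ boxEdges 4 (2 * H + 1)) :
    ellq (gaugeTransformZd (spreadGauge H U) (forestFix H U) (x, i)) ≤ 150 * (H : ℝ) * s := by
  have hH' : (1 : ℝ) ≤ H := by exact_mod_cast hH
  have hHpos : (0 : ℝ) < H := by linarith
  have hbox := mem_boxEdges_iff.1 hx
  have h0 : 0 ≤ x 0 := (hbox.1 0).1
  have h0' : x 0 ≤ 2 * (H : ℤ) := by have := (hbox.1 0).2; push_cast at this; omega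
  have hxi : x i + 1 ≤ 2 * (H : ℤ) := by have := hbox.2; push_cast at this; omega
  set V := forestFix H U with hVdef
  set x' : Site 4 := x + Pi.single i 1 with hx'def
  have hx'0 : x' 0 = x 0 := by simp [hx'def, Pi.single_eq_of_ne (Ne.symm hi)]
  have hcol' : col x' = col x + Pi.single i 1 := col_add_single_of_ne x hi
  -- the forest spatial link itself
  have hVxi : ellq (V (x, i)) ≤ 6 * (H : ℝ) * s := ellq_forestFix_spatial_le hH hs hW hS hi h0 h0'
  -- the two column holonomies and their roots
  set hy := V (col x, 0) with hy_def
  set hy' := V (col x', 0) with hy'_def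
  set t := 2 * H - (x 0).toNat with ht_def
  have ht2 : (t : ℝ) ≤ ((2 * H : ℕ) : ℝ) := by exact_mod_cast Nat.sub_le _ _
  have hm0 : (0 : ℝ) < ((2 * H : ℕ) : ℝ) := by push_cast; linarith
  have hdiff : ‖su2Quat hy - su2Quat hy'‖ ≤ 8 * (H : ℝ) * s := by
    rw [hy_def, hy'_def, hcol']
    exact norm_colHol_sub_le hH hs hW hS (col_apply_zero x) hi
  have hre : 0 ≤ (su2Quat hy).re := re_colHol_nonneg hH hs hc hW hS _
  have hre' : 0 ≤ (su2Quat hy').re := re_colHol_nonneg hH hs hc hW hS _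
  -- root powers: `‖q(k^t) − q(k'^t)‖ ≤ 18·8Hs` and `ℓ(k^t) ≤ (π/2)·ℓ(h)`
  have hroots : ‖su2Quat (kroot (2 * H) hy ^ t) - su2Quat (kroot (2 * H) hy' ^ t)‖ ≤ 144 * (H : ℝ) * s := by
    have h1 := norm_su2Quat_pow_sub_pow_le (kroot (2 * H) hy) (kroot (2 * H) hy') t
    have h2 := norm_kroot_sub_kroot_le (2 * H) hre hre'
    calc ‖su2Quat (kroot (2 * H) hy ^ t) - su2Quat (kroot (2 * H) hy' ^ t)‖
        ≤ t * ‖su2Quat (kroot (2 * H) hy) - su2Quat (kroot (2 * H) hy')‖ := h1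
      _ ≤ ((2 * H : ℕ) : ℝ) * (18 * ‖su2Quat hy - su2Quat hy'‖ / ((2 * H : ℕ) : ℝ)) :=
          mul_le_mul ht2 h2 (norm_nonneg _) hm0.le
      _ = 18 * ‖su2Quat hy - su2Quat hy'‖ := by field_simp
      _ ≤ 18 * (8 * (H : ℝ) * s) := by gcongr
      _ = 144 * (H : ℝ) * s := by ring
  have hrootpow : ∀ h : SU2, ellq (kroot (2 * H) h ^ t) ≤ 2 * ellq h := by
    intro h
    have h1 := ellq_pow_le (kroot (2 * H) h) t
    have h2 := norm_kroot_sub_one_le (2 * H) h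
    have hπ := Real.pi_le_four
    rw [← ellq, ← ellq] at h2
    calc ellq (kroot (2 * H) h ^ t) ≤ t * ellq (kroot (2 * H) h) := h1
      _ ≤ ((2 * H : ℕ) : ℝ) * (π / 2 * ellq h / ((2 * H : ℕ) : ℝ)) := mul_le_mul ht2 h2 (ellq_nonneg _) hm0.le
      _ = π / 2 * ellq h := by field_simp
      _ ≤ 2 * ellq h := by nlinarith [ellq_nonneg h]
  show ellq (spreadGauge H U x * V (x, i) * (spreadGauge H U x')⁻¹) ≤ _
  by_cases hxin : ∀ k : Fin 4, 1 ≤ x k ∧ x k + 1 ≤ 2 * (H : ℤ)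
  · by_cases hx'in : ∀ k : Fin 4, 1 ≤ x' k ∧ x' k + 1 ≤ 2 * (H : ℤ)
    · -- (A) both ends interior: `k^t · V · (k'^t)⁻¹`
      rw [spreadGauge_of_interior U hxin, spreadGauge_of_interior U hx'in, hx'0, ← hVdef, ← hy_def, ← hy'_def, ← ht_def, ellq,
        LandauBall.su2Quat_mul_mul_inv]
      calc ‖su2Quat (kroot (2 * H) hy ^ t) * su2Quat (V (x, i)) * star (su2Quat (kroot (2 * H) hy' ^ t)) - 1‖
          ≤ ‖su2Quat (V (x, i)) - 1‖ + ‖su2Quat (kroot (2 * H) hy ^ t) - su2Quat (kroot (2 * H) hy' ^ t)‖ :=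
            norm_mul_mul_star_sub_one_le (norm_su2Quat _) (norm_su2Quat _) _
        _ ≤ 6 * (H : ℝ) * s + 144 * (H : ℝ) * s := add_le_add hVxi hroots
        _ = 150 * (H : ℝ) * s := by ring
    · -- (B) `x` interior, `x + eᵢ` on the face `xᵢ = 2H`: `k^t · V`, and `h_{y'}` is a skin link
      have hface : x' i = 2 * (H : ℤ) := by
        have hxi' : x' i = x i + 1 := by simp [hx'def]
        by_contra hne
        apply hx'in
        intro k
        by_cases hk : k = i
        · subst hk
          have hk1 := hxin k
          rw [hxi'] at hne ⊢
          constructor <;> omega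
        · have : x' k = x k := by simp [hx'def, Pi.single_eq_of_ne hk]
          rw [this]; exact hxin k
      have hsk : ellq hy' ≤ s :=
        ellq_forestFix_temporal_face_le hs hW hS hi (Or.inr (by rw [col_apply_of_ne _ hi]; exact hface))
      have hhy : ellq hy ≤ 8 * (H : ℝ) * s + s := by
        have : ellq hy ≤ ‖su2Quat hy - su2Quat hy'‖ + ellq hy' := by
          rw [ellq, ellq]; exact norm_sub_le_norm_sub_add_norm_sub _ _ _
        linarith
      rw [spreadGauge_of_interior U hxin, spreadGauge_of_not_interior U hx'in, ← hVdef, ← hy_def, ← ht_def, inv_one, mul_one]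
      calc ellq (kroot (2 * H) hy ^ t * V (x, i)) ≤ ellq (kroot (2 * H) hy ^ t) + ellq (V (x, i)) := ellq_mul_le _ _
        _ ≤ 2 * (8 * (H : ℝ) * s + s) + 6 * (H : ℝ) * s := add_le_add ((hrootpow hy).trans (by linarith)) hVxi
        _ ≤ 150 * (H : ℝ) * s := by nlinarith
  · by_cases hx'in : ∀ k : Fin 4, 1 ≤ x' k ∧ x' k + 1 ≤ 2 * (H : ℤ)
    · -- (C) `x` on the face `xᵢ = 0`, `x + eᵢ` interior: `V · (k'^t)⁻¹`, and `h_y` is a skin link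
      have hface : x i = 0 := by
        have hxi' : x' i = x i + 1 := by simp [hx'def]
        by_contra hne
        apply hxin
        intro k
        by_cases hk : k = i
        · subst hk
          have := hx'in k; rw [hxi'] at this
          have h0k := (hbox.1 k).1
          constructor <;> omega
        · have : x' k = x k := by simp [hx'def, Pi.single_eq_of_ne hk]
          rw [← this]; exact hx'in k
      have hsk : ellq hy ≤ s :=
        ellq_forestFix_temporal_face_le hs hW hS hi (Or.inl (by rw [col_apply_of_ne _ hi]; exact hface))
      have hhy' : ellq hy' ≤ 8 * (H : ℝ) * s + s := by
        have : ellq hy' ≤ ‖su2Quat hy' - su2Quat hy‖ + ellq hy := by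
          rw [ellq, ellq]; exact norm_sub_le_norm_sub_add_norm_sub _ _ _
        rw [norm_sub_rev] at this
        linarith
      rw [spreadGauge_of_not_interior U hxin, spreadGauge_of_interior U hx'in, hx'0, ← hVdef, ← hy'_def, ← ht_def, one_mul]
      calc ellq (V (x, i) * (kroot (2 * H) hy' ^ t)⁻¹) ≤ ellq (V (x, i)) + ellq (kroot (2 * H) hy' ^ t)⁻¹ := ellq_mul_le _ _
        _ ≤ 6 * (H : ℝ) * s + 2 * (8 * (H : ℝ) * s + s) := by
            rw [ellq_inv]; exact add_le_add hVxi ((hrootpow hy').trans (by linarith))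
        _ ≤ 150 * (H : ℝ) * s := by nlinarith
    · -- (D) neither end interior: the link is the forest link
      rw [spreadGauge_of_not_interior U hxin, spreadGauge_of_not_interior U hx'in, one_mul, inv_one, mul_one]
      nlinarith

/-- **Every box link of the uniformised configuration is within `150·H·s` of `1`** (quaternion length), on `ColdWall ∧ SmallPlaquettes s` with
`s·H² ≤ 1/16`. -/
theorem ellq_uniform_link_le (hH : 1 ≤ H) (hs : 0 ≤ s) (hc : s * (H : ℝ) ^ 2 ≤ 1 / 16) (hW : ColdWall H U)
    (hS : SmallPlaquettes H s U) {e : Literature.MathematicalPhysics.QuantumLattice.ZdEdge 4} (he : e ∈ boxEdges 4 (2 * H + 1)) :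
    ellq (gaugeTransformZd (uniformGauge H U) U e) ≤ 150 * (H : ℝ) * s := by
  have hH' : (1 : ℝ) ≤ H := by exact_mod_cast hH
  rw [gaugeTransformZd_uniformGauge]
  obtain ⟨x, i⟩ := e
  by_cases hi : i = 0
  · subst hi
    have h := ellq_uniform_temporal_le hH hs hW hS he
    nlinarith
  · exact ellq_uniform_spatial_le hH hs hc hW hS hi he

end Bound

/-! ## §6 The two task Props -/

/-- **T-U2.S, first form: `UniformGaugeBound`** with `C = 150`, `c = 1/16`. -/
theorem uniformGaugeBound : UniformGaugeBound := by
  refine ⟨150, 1 / 16, by norm_num, by norm_num, fun H hH s hs hc U hW hS => ?_⟩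
  refine ⟨uniformGauge H U, uniformGauge_isInteriorGauge H U, fun e he => ?_⟩
  rw [← ellq_sq_eq_linkDefect]
  exact pow_le_pow_left₀ (ellq_nonneg _) (ellq_uniform_link_le hH hs hc hW hS he) 2

/-- **T-U2.S, summed form: `SharpStageI`** with `C = 7290000`, `c = 1/16` (`#boxEdges ≤ 4(2H+1)⁴ ≤ 324H⁴`, per link `(150Hs)²`). -/
theorem sharpStageI : SharpStageI := by
  refine ⟨7290000, 1 / 16, by norm_num, by norm_num, fun H hH s hs hc U hW hS => ?_⟩
  refine ⟨uniformGauge H U, uniformGauge_isInteriorGauge H U, ?_⟩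
  have hH' : (1 : ℝ) ≤ H := by exact_mod_cast hH
  have h1 : ∑ e ∈ boxEdges 4 (2 * H + 1), linkDefect (gaugeTransformZd (uniformGauge H U) U) e ≤
      ∑ e ∈ boxEdges 4 (2 * H + 1), (150 * (H : ℝ) * s) ^ 2 := by
    refine Finset.sum_le_sum fun e he => ?_
    rw [← ellq_sq_eq_linkDefect]
    exact pow_le_pow_left₀ (ellq_nonneg _) (ellq_uniform_link_le hH hs hc hW hS he) 2
  rw [Finset.sum_const, nsmul_eq_mul] at h1
  have hcard : ((boxEdges 4 (2 * H + 1)).card : ℝ) ≤ 4 * (2 * (H : ℝ) + 1) ^ 4 := by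
    exact_mod_cast card_boxEdges_four_le (2 * H + 1)
  have h2 : (2 * (H : ℝ) + 1) ^ 4 ≤ (3 * (H : ℝ)) ^ 4 := pow_le_pow_left₀ (by positivity) (by linarith) 4
  calc ∑ e ∈ boxEdges 4 (2 * H + 1), linkDefect (gaugeTransformZd (uniformGauge H U) U) e
      ≤ ((boxEdges 4 (2 * H + 1)).card : ℝ) * (150 * (H : ℝ) * s) ^ 2 := h1
    _ ≤ (4 * (3 * (H : ℝ)) ^ 4) * (150 * (H : ℝ) * s) ^ 2 :=
        mul_le_mul_of_nonneg_right (hcard.trans (by linarith)) (by positivity)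
    _ = 7290000 * (H : ℝ) ^ 6 * s ^ 2 := by ring

end Summit.QuantumFields.YangMills.Theorems.AllWindowsColdBoxBoxHighLine.UniformGauge

end
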